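import Summits.HubbardSuperconductivity.HubbardSuperconductivity.Theorems.AnisotropyChordTransferFibre3FinXCCover

/-!
# Route `AnisotropyChord` / H0 rotor rung: FIN combined (rows `N₁` + C) certificate at `L = 9` — cell facts, part `k`

Kernel facts `xbcCellAny 9 (49/50) 20 la lb (c, bn) = true` (`decide +kernel`, zero data) for 8 λ-cells of the per-`L` cover
(`…FinXCCover.xbcCheck`; cell design: p3 g5 scratch `xbc_design.py`, mirrors `xb_mirror.py`/`xc_mirror.py`); assembled in `…FinXBCNine`.
Prover seat `hubbard-h0-rotor-p3` g5; helper for piece A = stmt-HubbardSuperconductivity-23918 of rung 19089 (`--supports`, helper class).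
WHAT THIS IS NOT: nothing here proves superconductivity in the Hubbard model (rotor TARGET as worded stays FALSE, g15 verdict); kernel facts for the FIN certificate of two hypotheses (rows `N₁`, C) of ONE conditional reduction.  Tree imports only; no sorry, no new axioms.
-/

set_option linter.dupNamespace false

namespace Summit.HubbardSuperconductivity.HubbardSuperconductivity.Theorems.AnisotropyChord.Transfer.Fibre3

namespace FinXB

set_option maxHeartbeats 4000000 in
/-- kernel fact: cell 92 at `L = 9` (certified, c = (9/20 : ℚ), b = 14/20). [folklore] -/
theorem xbc9_92 : xbcCellAny 9 (49/50 : ℚ) 20 6728074935360578 6896276808744593 ((9/20 : ℚ), (14 : ℕ)) = true := by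
  decide +kernel

set_option maxHeartbeats 4000000 in
/-- kernel fact: cell 93 at `L = 9` (certified, c = (9/20 : ℚ), b = 14/20). [folklore] -/
theorem xbc9_93 : xbcCellAny 9 (49/50 : ℚ) 20 6896276808744593 7068683728963208 ((9/20 : ℚ), (14 : ℕ)) = true := by
  decide +kernel

set_option maxHeartbeats 4000000 in
/-- kernel fact: cell 94 at `L = 9` (certified, c = (9/20 : ℚ), b = 14/20). [folklore] -/
theorem xbc9_94 : xbcCellAny 9 (49/50 : ℚ) 20 7068683728963208 7245400822187289 ((9/20 : ℚ), (14 : ℕ)) = true := by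
  decide +kernel

set_option maxHeartbeats 4000000 in
/-- kernel fact: cell 95 at `L = 9` (certified, c = (9/20 : ℚ), b = 14/20). [folklore] -/
theorem xbc9_95 : xbcCellAny 9 (49/50 : ℚ) 20 7245400822187289 7426535842741972 ((9/20 : ℚ), (14 : ℕ)) = true := by
  decide +kernel

set_option maxHeartbeats 4000000 in
/-- kernel fact: cell 96 at `L = 9` (certified, c = (9/20 : ℚ), b = 14/20). [folklore] -/
theorem xbc9_96 : xbcCellAny 9 (49/50 : ℚ) 20 7426535842741972 7612199238810522 ((9/20 : ℚ), (14 : ℕ)) = true := by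
  decide +kernel

set_option maxHeartbeats 4000000 in
/-- kernel fact: cell 97 at `L = 9` (certified, c = (9/20 : ℚ), b = 15/20). [folklore] -/
theorem xbc9_97 : xbcCellAny 9 (49/50 : ℚ) 20 7612199238810522 7802504219780785 ((9/20 : ℚ), (15 : ℕ)) = true := by
  decide +kernel

set_option maxHeartbeats 4000000 in
/-- kernel fact: cell 98 at `L = 9` (certified, c = (9/20 : ℚ), b = 15/20). [folklore] -/
theorem xbc9_98 : xbcCellAny 9 (49/50 : ℚ) 20 7802504219780785 7997566825275305 ((9/20 : ℚ), (15 : ℕ)) = true := by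
  decide +kernel

set_option maxHeartbeats 4000000 in
/-- kernel fact: cell 99 at `L = 9` (certified, c = (9/20 : ℚ), b = 15/20). [folklore] -/
theorem xbc9_99 : xbcCellAny 9 (49/50 : ℚ) 20 7997566825275305 8197505995907188 ((9/20 : ℚ), (15 : ℕ)) = true := by
  decide +kernel

end FinXB

end Summit.HubbardSuperconductivity.HubbardSuperconductivity.Theorems.AnisotropyChord.Transfer.Fibre3
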